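import Summits.Ventures.PercRepro.RankLevelSet

/-!
# PercRepro — C-025 «RANK LEVEL-SET INEQUALITY»: Theorems A (q = 0) and C (r(E) = p + q) (p3, gen 6)

`conjectures/CONJECTURES.md` row C-025 (typer-2 `RankLevelSet.lean`, `C025`): for a finite matroid `M`,
`U(p,q) = {A ⊆ E : r(A) = p, r(E ∖ A) = q}`, `Y(p,q) = {A ⊆ E : q < r(A) < p}` and
`Φ(p,q) = Σ_{q<u<p} C(p+q,u) / C(p+q,p)` (`phiK`), the inequality `Φ(p,q)·|U(p,q)| ≤ |Y(p,q)|`; its LEVEL-WISE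
form (R1) is `C(p+q,u)·|U(p,q)| ≤ C(p+q,p)·W_u` with `W_u = #{S ⊆ E : r(S) = u}`.
This file proves the two cases of mine-2's `proofs/MINE2-RLS.md` §1–§2 as stated there, LOOPS ALLOWED
(no loopless hypothesis; the §0 halving remark is absorbed by a factor `2^{#loops}` on both sides):

* **`c025_of_rank_eq`** (Theorem C): `r(E) = p + q` ⇒ `Φ(p,q)·|U(p,q)| ≤ |Y(p,q)|` for ALL `p, q`
  (for `p ≤ q + 1` the left side is `0`). Proof: fix a base `B` (`|B| = p + q`) and write `Z` for the loops.
  For `A ∈ U(p,q)`, `B ∩ A` and `B ∩ (E ∖ A)` are independent of sizes `≤ p`, `≤ q` summing to `p + q`, hence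
  bases of `A` and of `E ∖ A` (`inter_base_structure`); as `cl(B ∩ A) ∩ cl(B ∩ (E ∖ A)) = cl ∅ = Z`
  (`Indep.closure_inter_eq_inter_closure`), `A ∖ Z = cl(B ∩ A) ∖ Z`, so `A ↦ (B ∩ A, A ∩ Z)` is an injection
  `U(p,q) → {p-subsets of B} × 𝒫 Z` (`ncard_U_le`: `|U| ≤ C(p+q,p)·2^{|Z|}`). Conversely `(B′, W) ↦ B′ ∪ W`
  is an injection `{B′ ⊆ B : q < |B′| < p} × 𝒫 Z → Y(p,q)` since loops do not change the rank
  (`le_ncard_Y`: `|Y| ≥ Σ_{q<u<p} C(p+q,u)·2^{|Z|}`). Multiply: `Φ(p,q)·C(p+q,p) = Σ_{q<u<p} C(p+q,u)`.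
* **`c025_of_q_zero`** (Theorem A): `Φ(p,0)·|U(p,0)| ≤ |Y(p,0)|` for every finite matroid and every `p`:
  `U(p,0) ≠ ∅` forces `r(E) = p` (`r(E) ≤ r(A) + r(E ∖ A) = p ≤ r(E)`, `eRank_eq_of_mem_U`), then Theorem C.
* **`c025_levelwise_of_rank_eq`**, **`c025_levelwise_of_q_zero`** — the (R1) LEVEL-WISE forms of the same two
  cases, every level `u` (`choose_mul_two_pow_le_ncard_rank`: `C(p+q,u)·2^{|Z|} ≤ W_u`, one level of `le_ncard_Y`).

Both set-builders are byte-identical to the body of `C025`; the hypotheses `q + 2 ≤ p` of the row are not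
needed. Helpers: `eRk_union_loops_subset`, `base_eq_inter_union_inter`, `union_inter_base_eq`,
`union_inter_loops_eq`. Paper: `proofs/MINE2-RLS.md` §0–§2 and §5 (R1) (mine-2). Axioms: standard.
-/

namespace PercRepro

open Set Matroid

variable {α : Type} {M : Matroid α}

/-- Adding loops to a set does not change its rank. -/
lemma eRk_union_loops_subset {X W : Set α} (hW : W ⊆ M.loops) : M.eRk (X ∪ W) = M.eRk X :=
  M.eRk_eq_eRk_union_eRk_le_zero X (by
    calc M.eRk W ≤ M.eRk M.loops := M.eRk_mono hW
      _ = 0 := M.eRk_loops)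

/-- The two parts of a base cut by `A` and its complement. -/
lemma base_eq_inter_union_inter {B A : Set α} (hB : M.IsBase B) (hA : A ⊆ M.E) :
    B = B ∩ A ∪ B ∩ (M.E \ A) := by
  rw [← inter_union_distrib_left, union_sdiff_cancel hA, inter_eq_left.2 hB.subset_ground]

/-- KEY STRUCTURE: in a matroid of rank `p + q`, for `A ⊆ E` with `r(A) = p`, `r(E ∖ A) = q`, and any base
`B`: `|B ∩ A| = p` and `A` agrees with `cl(B ∩ A)` outside the loops. -/
lemma inter_base_structure [M.Finite] {B A : Set α} {p q : ℕ} (hB : M.IsBase B) (hA : A ⊆ M.E)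
    (hpA : M.eRk A = p) (hqA : M.eRk (M.E \ A) = q) (hR : M.eRank = p + q) :
    (B ∩ A).ncard = p ∧ A \ M.loops = M.closure (B ∩ A) \ M.loops := by
  have hBfin : B.Finite := M.set_finite B hB.subset_ground
  have hfin₁ : (B ∩ A).Finite := hBfin.subset inter_subset_left
  have hfin₂ : (B ∩ (M.E \ A)).Finite := hBfin.subset inter_subset_left
  have hI₁ : M.Indep (B ∩ A) := hB.indep.subset inter_subset_left
  have hI₂ : M.Indep (B ∩ (M.E \ A)) := hB.indep.subset inter_subset_left
  have h₁ : (B ∩ A).encard ≤ p := (hI₁.encard_le_eRk_of_subset inter_subset_right).trans_eq hpA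
  have h₂ : (B ∩ (M.E \ A)).encard ≤ q :=
    (hI₂.encard_le_eRk_of_subset inter_subset_right).trans_eq hqA
  have hunion := base_eq_inter_union_inter hB hA
  have hdisj : Disjoint (B ∩ A) (B ∩ (M.E \ A)) := by
    rw [disjoint_left]
    rintro x ⟨-, hxA⟩ ⟨-, hxE, hxA'⟩
    exact hxA' hxA
  have hsum : (B ∩ A).encard + (B ∩ (M.E \ A)).encard = (p + q : ℕ) := by
    rw [← encard_union_eq hdisj, ← hunion, hB.encard_eq_eRank, hR]
    norm_cast
  rw [← hfin₁.cast_ncard_eq] at h₁ hsum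
  rw [← hfin₂.cast_ncard_eq] at h₂ hsum
  have h₁' : (B ∩ A).ncard ≤ p := by exact_mod_cast h₁
  have h₂' : (B ∩ (M.E \ A)).ncard ≤ q := by exact_mod_cast h₂
  have hsum' : (B ∩ A).ncard + (B ∩ (M.E \ A)).ncard = p + q := by exact_mod_cast hsum
  have hc₁ : (B ∩ A).ncard = p := by omega
  have hc₂ : (B ∩ (M.E \ A)).ncard = q := by omega
  refine ⟨hc₁, ?_⟩
  have hbas₁ : M.IsBasis (B ∩ A) A := by
    refine hI₁.isBasis_of_eRk_ge hfin₁ inter_subset_right ?_ hA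
    rw [hI₁.eRk_eq_encard, ← hfin₁.cast_ncard_eq, hc₁, hpA]
  have hbas₂ : M.IsBasis (B ∩ (M.E \ A)) (M.E \ A) := by
    refine hI₂.isBasis_of_eRk_ge hfin₂ inter_subset_right ?_ sdiff_subset
    rw [hI₂.eRk_eq_encard, ← hfin₂.cast_ncard_eq, hc₂, hqA]
  have hcl : M.closure (B ∩ A) ∩ M.closure (B ∩ (M.E \ A)) = M.loops := by
    have h := (hunion ▸ hB.indep).closure_inter_eq_inter_closure
    rw [← h, ← closure_empty]
    congr 1
    exact disjoint_iff_inter_eq_empty.1 hdisj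
  ext x
  constructor
  · rintro ⟨hxA, hxl⟩
    exact ⟨hbas₁.subset_closure hxA, hxl⟩
  · rintro ⟨hxcl, hxl⟩
    refine ⟨?_, hxl⟩
    by_contra hxA
    have hxE : x ∈ M.E := M.closure_subset_ground _ hxcl
    have hx₂ : x ∈ M.closure (B ∩ (M.E \ A)) := hbas₂.subset_closure ⟨hxE, hxA⟩
    exact hxl (hcl ▸ ⟨hxcl, hx₂⟩)

/-- `|U(p,q)| ≤ C(p+q, p) · 2^{#loops}` when `r(E) = p + q`: `A ↦ (B ∩ A, A ∩ loops)` is injective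
into (`p`-subsets of a base `B`) × (subsets of the loops). -/
lemma ncard_U_le [M.Finite] {p q : ℕ} (hR : M.eRank = p + q) :
    {A : Set α | A ⊆ M.E ∧ M.eRk A = (p : ℕ∞) ∧ M.eRk (M.E \ A) = (q : ℕ∞)}.ncard ≤
      (p + q).choose p * 2 ^ M.loops.ncard := by
  obtain ⟨B, hB⟩ := M.exists_isBase
  have hBfin : B.Finite := M.set_finite B hB.subset_ground
  have hZfin : M.loops.Finite := M.set_finite M.loops M.loops_subset_ground
  have hBcard : B.ncard = p + q := by
    have h := hB.encard_eq_eRank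
    rw [hR, ← hBfin.cast_ncard_eq] at h
    exact_mod_cast h
  have hTfin : ({t : Set α | t ⊆ B ∧ t.ncard = p} ×ˢ 𝒫 M.loops).Finite :=
    (hBfin.finite_subsets.subset (fun t ht => ht.1)).prod hZfin.powerset
  have hTcard : ({t : Set α | t ⊆ B ∧ t.ncard = p} ×ˢ 𝒫 M.loops).ncard =
      (p + q).choose p * 2 ^ M.loops.ncard := by
    rw [ncard_prod, ncard_powerset_ncard hBfin, hBcard, ncard_powerset _ hZfin]
  rw [← hTcard]
  refine ncard_le_ncard_of_injOn (fun A => (B ∩ A, A ∩ M.loops)) ?_ ?_ hTfin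
  · rintro A ⟨hA, hpA, hqA⟩
    obtain ⟨hc, -⟩ := inter_base_structure hB hA hpA hqA hR
    exact ⟨⟨inter_subset_left, hc⟩, inter_subset_right⟩
  · rintro A ⟨hA, hpA, hqA⟩ A' ⟨hA', hpA', hqA'⟩ hEq
    simp only [Prod.mk.injEq] at hEq
    obtain ⟨-, h₁⟩ := inter_base_structure hB hA hpA hqA hR
    obtain ⟨-, h₁'⟩ := inter_base_structure hB hA' hpA' hqA' hR
    rw [← sdiff_union_inter A M.loops, ← sdiff_union_inter A' M.loops, h₁, h₁', hEq.1, hEq.2]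

/-- A set inside `B` is recovered from its union with a set of loops. -/
lemma union_inter_base_eq {B X W : Set α} (hB : M.IsBase B) (hX : X ⊆ B) (hW : W ⊆ M.loops) :
    (X ∪ W) ∩ B = X := by
  have hWB : W ∩ B = ∅ :=
    disjoint_iff_inter_eq_empty.1 ((hB.indep.disjoint_loops.symm).mono_left hW)
  rw [union_inter_distrib_right, inter_eq_left.2 hX, hWB, union_empty]

/-- A set of loops is recovered from its union with a subset of a base. -/
lemma union_inter_loops_eq {B X W : Set α} (hB : M.IsBase B) (hX : X ⊆ B) (hW : W ⊆ M.loops) :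
    (X ∪ W) ∩ M.loops = W := by
  have hXZ : X ∩ M.loops = ∅ :=
    disjoint_iff_inter_eq_empty.1 (hB.indep.disjoint_loops.mono_left hX)
  rw [union_inter_distrib_right, hXZ, inter_eq_left.2 hW, empty_union]

/-- `Σ_{q<u<p} C(p+q, u) · 2^{#loops} ≤ |Y(p,q)|` when `r(E) = p + q`: `(B', W) ↦ B' ∪ W` is injective
from (subsets of a base of size strictly between `q` and `p`) × (subsets of the loops) into `Y`. -/
lemma le_ncard_Y [M.Finite] {p q : ℕ} (hR : M.eRank = p + q) :
    (∑ u ∈ Finset.Ioo q p, (p + q).choose u) * 2 ^ M.loops.ncard ≤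
      {A : Set α | A ⊆ M.E ∧ (q : ℕ∞) < M.eRk A ∧ M.eRk A < (p : ℕ∞)}.ncard := by
  classical
  obtain ⟨B, hB⟩ := M.exists_isBase
  have hBfin : B.Finite := M.set_finite B hB.subset_ground
  have hZfin : M.loops.Finite := M.set_finite M.loops M.loops_subset_ground
  have hBcard : hBfin.toFinset.card = p + q := by
    have h := hB.encard_eq_eRank
    rw [hR, ← hBfin.cast_ncard_eq, ncard_eq_toFinset_card B hBfin] at h
    exact_mod_cast h
  have hZcard : hZfin.toFinset.card = M.loops.ncard := (ncard_eq_toFinset_card _ hZfin).symm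
  set F : Finset (Finset α) :=
    (Finset.Ioo q p).biUnion (fun u => hBfin.toFinset.powersetCard u) with hF
  have hFcard : F.card = ∑ u ∈ Finset.Ioo q p, (p + q).choose u := by
    rw [hF, Finset.card_biUnion]
    · exact Finset.sum_congr rfl (fun u _ => by rw [Finset.card_powersetCard, hBcard])
    · intro u _ v _ huv
      change Disjoint _ _
      rw [Finset.disjoint_left]
      intro s hs hs'
      rw [Finset.mem_powersetCard] at hs hs'
      exact huv (hs.2.symm.trans hs'.2)
  have hYfin : {A : Set α | A ⊆ M.E ∧ (q : ℕ∞) < M.eRk A ∧ M.eRk A < (p : ℕ∞)}.Finite :=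
    (M.set_finite M.E).finite_subsets.subset (fun A hA => hA.1)
  -- membership in the source unpacked
  have hmem : ∀ sw ∈ (F ×ˢ hZfin.toFinset.powerset : Finset (Finset α × Finset α)),
      (sw.1 : Set α) ⊆ B ∧ (sw.2 : Set α) ⊆ M.loops ∧ ∃ u ∈ Finset.Ioo q p, sw.1.card = u := by
    rintro ⟨s, w⟩ hsw
    rw [Finset.mem_product] at hsw
    obtain ⟨hs, hw⟩ := hsw
    rw [hF, Finset.mem_biUnion] at hs
    obtain ⟨u, hu, hs⟩ := hs
    rw [Finset.mem_powersetCard] at hs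
    rw [Finset.mem_powerset] at hw
    refine ⟨fun x hx => ?_, fun x hx => ?_, u, hu, hs.2⟩
    · have := hs.1 hx
      rwa [hBfin.mem_toFinset] at this
    · have := hw hx
      rwa [hZfin.mem_toFinset] at this
  have key : ((F ×ˢ hZfin.toFinset.powerset : Finset (Finset α × Finset α)) :
      Set (Finset α × Finset α)).ncard ≤
      {A : Set α | A ⊆ M.E ∧ (q : ℕ∞) < M.eRk A ∧ M.eRk A < (p : ℕ∞)}.ncard := by
    refine ncard_le_ncard_of_injOn (fun sw => ((sw.1 : Set α) ∪ (sw.2 : Set α))) ?_ ?_ hYfin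
    · intro sw hsw
      obtain ⟨hsB, hwZ, u, hu, hcard⟩ := hmem sw hsw
      have hrk : M.eRk ((sw.1 : Set α) ∪ sw.2) = (u : ℕ∞) := by
        rw [eRk_union_loops_subset hwZ, (hB.indep.subset hsB).eRk_eq_encard,
          encard_coe_eq_coe_finsetCard, hcard]
      rw [Finset.mem_Ioo] at hu
      refine ⟨union_subset (hsB.trans hB.subset_ground) (hwZ.trans M.loops_subset_ground), ?_, ?_⟩
      · rw [hrk]; exact_mod_cast hu.1
      · rw [hrk]; exact_mod_cast hu.2
    · intro sw hsw sw' hsw' hEq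
      obtain ⟨hsB, hwZ, -⟩ := hmem sw hsw
      obtain ⟨hsB', hwZ', -⟩ := hmem sw' hsw'
      simp only at hEq
      have h1 : (sw.1 : Set α) = sw'.1 := by
        rw [← union_inter_base_eq hB hsB hwZ, ← union_inter_base_eq hB hsB' hwZ', hEq]
      have h2 : (sw.2 : Set α) = sw'.2 := by
        rw [← union_inter_loops_eq hB hsB hwZ, ← union_inter_loops_eq hB hsB' hwZ', hEq]
      exact Prod.ext (Finset.coe_injective h1) (Finset.coe_injective h2)
  rw [ncard_coe_finset, Finset.card_product, hFcard, Finset.card_powerset, hZcard] at key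
  exact key

/-- **C-025, Theorem C (r(E) = p + q), with loops allowed** (mine-2, MINE2-RLS.md §2): for every finite
matroid `M` of rank `p + q` and all `p, q` (for `p ≤ q + 1` the left side is `0`),
`Φ(p,q) · #{A ⊆ E : r(A) = p, r(E ∖ A) = q} ≤ #{A ⊆ E : q < r(A) < p}` — the `C025` body for such `M`. -/
theorem c025_of_rank_eq [M.Finite] (p q : ℕ) (hR : M.eRank = p + q) :
    phiK p q * ({A : Set α | A ⊆ M.E ∧ M.eRk A = (p : ℕ∞) ∧ M.eRk (M.E \ A) = (q : ℕ∞)}.ncard : ℚ) ≤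
      ({A : Set α | A ⊆ M.E ∧ (q : ℕ∞) < M.eRk A ∧ M.eRk A < (p : ℕ∞)}.ncard : ℚ) := by
  have hU := ncard_U_le (M := M) hR
  have hY := le_ncard_Y (M := M) hR
  have hchoose : (0 : ℚ) < ((p + q).choose p : ℚ) := by
    exact_mod_cast Nat.choose_pos (by omega)
  have hphi : phiK p q * ((p + q).choose p : ℚ) =
      ∑ u ∈ Finset.Ioo q p, ((p + q).choose u : ℚ) := by
    unfold phiK
    rw [div_mul_cancel₀ _ hchoose.ne']
  have hphi_nonneg : 0 ≤ phiK p q := by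
    unfold phiK
    positivity
  calc phiK p q * ({A : Set α | A ⊆ M.E ∧ M.eRk A = (p : ℕ∞) ∧ M.eRk (M.E \ A) = (q : ℕ∞)}.ncard : ℚ)
      ≤ phiK p q * (((p + q).choose p * 2 ^ M.loops.ncard : ℕ) : ℚ) :=
        mul_le_mul_of_nonneg_left (by exact_mod_cast hU) hphi_nonneg
    _ = (∑ u ∈ Finset.Ioo q p, ((p + q).choose u : ℚ)) * 2 ^ M.loops.ncard := by
        push_cast
        rw [← mul_assoc, hphi]
    _ = (((∑ u ∈ Finset.Ioo q p, (p + q).choose u) * 2 ^ M.loops.ncard : ℕ) : ℚ) := by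
        push_cast
        ring
    _ ≤ ({A : Set α | A ⊆ M.E ∧ (q : ℕ∞) < M.eRk A ∧ M.eRk A < (p : ℕ∞)}.ncard : ℚ) := by
        exact_mod_cast hY

/-- `U(p, 0) ≠ ∅` forces `r(E) = p` (`r(E) ≤ r(A) + r(E ∖ A) = p ≤ r(E)`). -/
lemma eRank_eq_of_mem_U {A : Set α} {p : ℕ} (hA : A ⊆ M.E) (hpA : M.eRk A = p)
    (hqA : M.eRk (M.E \ A) = ((0 : ℕ) : ℕ∞)) : M.eRank = (p : ℕ∞) + ((0 : ℕ) : ℕ∞) := by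
  apply le_antisymm
  · calc M.eRank = M.eRk M.E := M.eRank_def
        _ = M.eRk (A ∪ (M.E \ A)) := by rw [union_sdiff_cancel hA]
        _ ≤ M.eRk A + M.eRk (M.E \ A) := M.eRk_union_le_eRk_add_eRk _ _
        _ = (p : ℕ∞) + ((0 : ℕ) : ℕ∞) := by rw [hpA, hqA]
  · calc (p : ℕ∞) + ((0 : ℕ) : ℕ∞) = M.eRk A := by rw [hpA]; simp
        _ ≤ M.eRank := M.eRk_le_eRank A

/-- **C-025, Theorem A (q = 0), with loops allowed** (mine-2, MINE2-RLS.md §1): for every finite matroid `M`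
and every `p` (for `p ≤ 1` the left side is `0`), `Φ(p,0) · #{A ⊆ E : r(A) = p, r(E ∖ A) = 0} ≤ #{A ⊆ E : 0 < r(A) < p}` — the `C025`
body at `q = 0`. -/
theorem c025_of_q_zero [M.Finite] (p : ℕ) :
    phiK p 0 * ({A : Set α | A ⊆ M.E ∧ M.eRk A = (p : ℕ∞) ∧ M.eRk (M.E \ A) = ((0 : ℕ) : ℕ∞)}.ncard : ℚ) ≤
      ({A : Set α | A ⊆ M.E ∧ ((0 : ℕ) : ℕ∞) < M.eRk A ∧ M.eRk A < (p : ℕ∞)}.ncard : ℚ) := by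
  by_cases hU : {A : Set α | A ⊆ M.E ∧ M.eRk A = (p : ℕ∞) ∧ M.eRk (M.E \ A) = ((0 : ℕ) : ℕ∞)} = ∅
  · rw [hU, ncard_empty]
    simp
  · obtain ⟨A, hA, hpA, hqA⟩ := nonempty_iff_ne_empty.2 hU
    exact c025_of_rank_eq p 0 (eRank_eq_of_mem_U hA hpA hqA)

/-- One level of `le_ncard_Y`: `C(p+q, u) · 2^{#loops} ≤ #{S ⊆ E : r(S) = u}` for every `u` when `r(E) = p + q`
(`(B′, W) ↦ B′ ∪ W` from the `u`-subsets of a base times the subsets of the loops). -/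
lemma choose_mul_two_pow_le_ncard_rank [M.Finite] {p q : ℕ} (hR : M.eRank = p + q) (u : ℕ) :
    (p + q).choose u * 2 ^ M.loops.ncard ≤ {S : Set α | S ⊆ M.E ∧ M.eRk S = (u : ℕ∞)}.ncard := by
  classical
  obtain ⟨B, hB⟩ := M.exists_isBase
  have hBfin : B.Finite := M.set_finite B hB.subset_ground
  have hZfin : M.loops.Finite := M.set_finite M.loops M.loops_subset_ground
  have hBcard : hBfin.toFinset.card = p + q := by
    have h := hB.encard_eq_eRank
    rw [hR, ← hBfin.cast_ncard_eq, ncard_eq_toFinset_card B hBfin] at h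
    exact_mod_cast h
  have hZcard : hZfin.toFinset.card = M.loops.ncard := (ncard_eq_toFinset_card _ hZfin).symm
  have hWfin : {S : Set α | S ⊆ M.E ∧ M.eRk S = (u : ℕ∞)}.Finite :=
    (M.set_finite M.E).finite_subsets.subset (fun A hA => hA.1)
  have hmem : ∀ sw ∈ (hBfin.toFinset.powersetCard u ×ˢ hZfin.toFinset.powerset :
      Finset (Finset α × Finset α)),
      (sw.1 : Set α) ⊆ B ∧ (sw.2 : Set α) ⊆ M.loops ∧ sw.1.card = u := by
    rintro ⟨s, w⟩ hsw
    rw [Finset.mem_product, Finset.mem_powersetCard, Finset.mem_powerset] at hsw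
    obtain ⟨⟨hs, hcard⟩, hw⟩ := hsw
    refine ⟨fun x hx => ?_, fun x hx => ?_, hcard⟩
    · have := hs hx
      rwa [hBfin.mem_toFinset] at this
    · have := hw hx
      rwa [hZfin.mem_toFinset] at this
  have key : ((hBfin.toFinset.powersetCard u ×ˢ hZfin.toFinset.powerset :
      Finset (Finset α × Finset α)) : Set (Finset α × Finset α)).ncard ≤
      {S : Set α | S ⊆ M.E ∧ M.eRk S = (u : ℕ∞)}.ncard := by
    refine ncard_le_ncard_of_injOn (fun sw => ((sw.1 : Set α) ∪ (sw.2 : Set α))) ?_ ?_ hWfin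
    · intro sw hsw
      obtain ⟨hsB, hwZ, hcard⟩ := hmem sw hsw
      refine ⟨union_subset (hsB.trans hB.subset_ground) (hwZ.trans M.loops_subset_ground), ?_⟩
      rw [eRk_union_loops_subset hwZ, (hB.indep.subset hsB).eRk_eq_encard,
        encard_coe_eq_coe_finsetCard, hcard]
    · intro sw hsw sw' hsw' hEq
      obtain ⟨hsB, hwZ, -⟩ := hmem sw hsw
      obtain ⟨hsB', hwZ', -⟩ := hmem sw' hsw'
      simp only at hEq
      have h1 : (sw.1 : Set α) = sw'.1 := by
        rw [← union_inter_base_eq hB hsB hwZ, ← union_inter_base_eq hB hsB' hwZ', hEq]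
      have h2 : (sw.2 : Set α) = sw'.2 := by
        rw [← union_inter_loops_eq hB hsB hwZ, ← union_inter_loops_eq hB hsB' hwZ', hEq]
      exact Prod.ext (Finset.coe_injective h1) (Finset.coe_injective h2)
  rw [ncard_coe_finset, Finset.card_product, Finset.card_powersetCard, hBcard, Finset.card_powerset,
    hZcard] at key
  exact key

/-- **C-025, Theorem C, LEVEL-WISE** (the (R1) form at `r(E) = p + q`): for every `u`,
`C(p+q, u) · #{A ⊆ E : r(A) = p, r(E ∖ A) = q} ≤ C(p+q, p) · #{S ⊆ E : r(S) = u}` (loops allowed). -/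
theorem c025_levelwise_of_rank_eq [M.Finite] (p q u : ℕ) (hR : M.eRank = p + q) :
    (p + q).choose u *
      {A : Set α | A ⊆ M.E ∧ M.eRk A = (p : ℕ∞) ∧ M.eRk (M.E \ A) = (q : ℕ∞)}.ncard ≤
      (p + q).choose p * {S : Set α | S ⊆ M.E ∧ M.eRk S = (u : ℕ∞)}.ncard := by
  have hU := ncard_U_le (M := M) hR
  have hW := choose_mul_two_pow_le_ncard_rank (M := M) hR u
  calc (p + q).choose u *
        {A : Set α | A ⊆ M.E ∧ M.eRk A = (p : ℕ∞) ∧ M.eRk (M.E \ A) = (q : ℕ∞)}.ncard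
      ≤ (p + q).choose u * ((p + q).choose p * 2 ^ M.loops.ncard) := Nat.mul_le_mul_left _ hU
    _ = (p + q).choose p * ((p + q).choose u * 2 ^ M.loops.ncard) := by ring
    _ ≤ (p + q).choose p * {S : Set α | S ⊆ M.E ∧ M.eRk S = (u : ℕ∞)}.ncard :=
        Nat.mul_le_mul_left _ hW

/-- **C-025, Theorem A, LEVEL-WISE** (the (R1) form at `q = 0`): for every finite matroid and every `u`,
`C(p, u) · #{A ⊆ E : r(A) = p, r(E ∖ A) = 0} ≤ #{S ⊆ E : r(S) = u}` (`C(p, p) = 1`). -/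
theorem c025_levelwise_of_q_zero [M.Finite] (p u : ℕ) :
    p.choose u *
      {A : Set α | A ⊆ M.E ∧ M.eRk A = (p : ℕ∞) ∧ M.eRk (M.E \ A) = ((0 : ℕ) : ℕ∞)}.ncard ≤
      {S : Set α | S ⊆ M.E ∧ M.eRk S = (u : ℕ∞)}.ncard := by
  by_cases hU :
      {A : Set α | A ⊆ M.E ∧ M.eRk A = (p : ℕ∞) ∧ M.eRk (M.E \ A) = ((0 : ℕ) : ℕ∞)} = ∅
  · rw [hU, ncard_empty, mul_zero]
    exact Nat.zero_le _
  · obtain ⟨A, hA, hpA, hqA⟩ := nonempty_iff_ne_empty.2 hU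
    have h := c025_levelwise_of_rank_eq (M := M) p 0 u (eRank_eq_of_mem_U hA hpA hqA)
    simpa using h

end PercRepro
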